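/- Copyright: the b2b-balaban cell (near-miss cell 7), T⁴-continuum fan-out; row NE7b CRUX team (2), seat
t4-ne7b-formalise-leaf-02 (gen 28; the row owner's INTERFACE REQUEST NE7b IR-45-1 «→ S12-W crew (leaf-03 custodian; E-side
leaf-02; leaf-05)», HOME/INBOX.md l.8656–8665, E-side supplier brick A under the located finding F-ne7bleaf02g28-1,
`CLAIMS.log` l.31462).  Released under the licence of the surrounding project. -/
import Summits.QuantumFields.BalabanUV.T4Continuum.Support.HistoryBankingVolumePlug

/-!
# The per-member price READ ON THE TREE: node sums, their naturality under relabelling, and the flat price of a KEY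
(INTERFACE REQUEST NE7b IR-45-1, E-side, module A)

Summits-side support leaf of the T⁴-continuum cell (rung (B)+1 on a FINITE torus only; NOT infinite volume, NOT the
mass gap, NOT the Clay statement; NOT a proof of the spine estimate NE7b, which is the cell's OWN estimate, NOT PRINTED
and NOT PROVED).  Row NE7b, route «COUNT» ∕ R-P1, re-open object (α), the supplier plug of the VS-witness's H3 price
fields (`HistoryRealiseCellsRunApexT3bWTVS.CountRoadWitnessT3bWTVS.priceM` ∕ `FcM`, p265435) over M2 brick B
(`B16HistoryPricePlug.weight_le_price_mul_dead`, p270346).  [folklore] elementary bookkeeping on the genealogy TREE;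
no `[cite:]` tag, nothing printed asserted, no `Prop` fact minted, zero `sorry`.

WHY (located finding F-ne7bleaf02g28-1, `CLAIMS.log` l.31462).  The witness's price family `FcM K` is a function of a
term's KEY family `kmemOf … K τ = (liveC K τ).image keyOf`, whose genealogy letter is the FLAT genealogy
`Pedigree.gen c = gmap Prod.fst (genT c) : Gen PEv`; the price sentence `priceM` is read over the TAGGED members
`q.2 = genT c : Gen (Lab α π)` through `Prod.fst`.  The event functionals that make the per-member price — `credits`,
`costT` (inside `lifeCost`), `totalCostT`, `birthWT` — are sums over the LABEL FINSET `G.events`, and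
`(gmap Prod.fst G).events = G.events.image Prod.fst` MERGES two events with the same dictionary letter
`(step, kind, fat)`: they are NOT natural under the flattening (kernel toy `ToyFlatUndercount`, leaf-02 g28), so the
tagged price is NOT the same functionals read on the key.  THIS FILE supplies the repair: every event functional is
re-expressed as a NODE SUM over the tree (every node contributes; a node's placement is read by POSITION — births at
their step, renewals at `h + 1`, mergers at the later partner reach — i.e. the values of `Gen.place`), which (i) is
natural under `gmap f` for EVERY map `f` (structural induction; `ZoneTransport.reach_gmap` for the merger placement) and
(ii) agrees with the `Finset` functional on WELL-FORMED genealogies (`Gen.WF`: distinct labels — `sum_insert` ∕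
`sum_union`).  Consequently the per-member price factor of `priceM` at a well-formed tagged genealogy `G` EQUALS the
flat price `priceN` of its key letter `gmap sh G` (`priceFactor_eq_priceN_gmap`), and module B (`HistoryPriceKeys`) can
define `FcM K k := ∏_{w ∈ k} priceN … w.2.1` with `priceM` holding WITH EQUALITY.

WHAT.  §1 `nsum f` ∕ `nsumP W F` (node sums without ∕ with positional placement), `nsum_gmap` ∕ `nsumP_gmap`;
§2 `nsum_eq_sum_events` ∕ `nsumP_eq_sum_place` under `G.WF W′` and the four corollaries `credits_eq_nsum`,
`costT_eq_nsumP`, `totalCostT_eq_nsumP`, `birthWT_eq_nsum`; §3 the flat letters `creditsN` ∕ `costN` ∕ `lifeCostN` ∕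
`totalCostN` ∕ `birthWN` on `Gen PEv`, the flat price `priceN`, the pull-backs along `gmap sh`, and
**`priceFactor_eq_priceN_gmap`**: for `G.WF W′`,
`pshapeTH sh O C Δ Λ′ R g D (costT sh C K R) G · e^{birthWT sh u G} · e^{−(8∕E₂·totalCostT sh C K R G + 4·partnerAges (PEv.step ∘ sh) G)}
 = priceN O C K Δ Λ′ R g D u (gmap sh G)`.

HONEST.  Bookkeeping identities of OUR model objects; no reading of Bałaban, no estimate; the H3 displays of the
VS-witness and of IR-45-1 (`HistRead`, `FactorRead` ∕ `RoundingRoom`, the volume calibration, `realised`, `resumM`)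
are untouched and stay R-class; headline p224237 ∕ E7T ∕ the V- and VS-headlines UNCHANGED BY NAME; NE7b NOT PRINTED ∕
NOT PROVED; spine 0∕9.  HONEST DEPENDENCY (cell): continuum YM on T⁴ ⇐ BetaPertH ∧ nine spine estimates (0/9 proved);
BetaPertH ⇐ (D1) ∧ (D4) ∧ CAP+tail; G-an2-4 gates asym, D1 and NE2/3/4.  This file changes none of it. -/

open Finset
open Literature.MathematicalPhysics.QuantumFieldTheory.Balaban1983to89
open T4PersistenceDictionary T4PrintedShapeBanking T4TaggedShapeBanking T4BankedInduction T4PartnerMultiplicity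
open Summit.QuantumFields.BalabanUV.T4Continuum.LateMergers
open Summit.QuantumFields.BalabanUV.T4Continuum.HistoryConstants
open Summit.QuantumFields.BalabanUV.T4Continuum.HistoryBankingLE
open Summit.QuantumFields.BalabanUV.T4Continuum.HistoryBankingVolumePlug
open Summit.QuantumFields.BalabanUV.T4Continuum.ZoneSkeleton

namespace Summit.QuantumFields.BalabanUV.T4Continuum.HistoryPriceNodeSum

noncomputable section

/-! ## §1 Node sums and their naturality under relabelling -/

section NodeSum

variable {ε ε' : Type*}

/-- **NODE SUM** of a per-event letter: every NODE of the tree contributes its label's letter (labels may repeat).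
[folklore] -/
def nsum (f : ε → ℝ) : Gen ε → ℝ
  | Gen.born b _ => f b
  | Gen.renew G e _ => nsum f G + f e
  | Gen.merge X Y e => nsum f X + nsum f Y + f e

/-- **NODE SUM WITH POSITIONAL PLACEMENT**: every node contributes `F (its placement) (its label)`, the placement read
off the POSITION — a birth at its step, a renewal at `h + 1`, a merger at the later partner reach against the table `W`
(the values of `Gen.place W`). [folklore] -/
def nsumP (W : ε → ℕ) (F : ℕ → ε → ℝ) : Gen ε → ℝ
  | Gen.born b j => F j b
  | Gen.renew G e h => nsumP W F G + F (h + 1) e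
  | Gen.merge X Y e => nsumP W F X + nsumP W F Y + F (max (X.reach W) (Y.reach W)) e

/-- node sum of a bare birth [folklore] -/
@[simp] theorem nsum_born (f : ε → ℝ) (b : ε) (j : ℕ) : nsum f (Gen.born b j) = f b := rfl
/-- node sum after a renewal [folklore] -/
@[simp] theorem nsum_renew (f : ε → ℝ) (G : Gen ε) (e : ε) (h : ℕ) :
    nsum f (Gen.renew G e h) = nsum f G + f e := rfl
/-- node sum after a merger [folklore] -/
@[simp] theorem nsum_merge (f : ε → ℝ) (X Y : Gen ε) (e : ε) :
    nsum f (Gen.merge X Y e) = nsum f X + nsum f Y + f e := rfl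
/-- placed node sum of a bare birth [folklore] -/
@[simp] theorem nsumP_born (W : ε → ℕ) (F : ℕ → ε → ℝ) (b : ε) (j : ℕ) : nsumP W F (Gen.born b j) = F j b := rfl
/-- placed node sum after a renewal [folklore] -/
@[simp] theorem nsumP_renew (W : ε → ℕ) (F : ℕ → ε → ℝ) (G : Gen ε) (e : ε) (h : ℕ) :
    nsumP W F (Gen.renew G e h) = nsumP W F G + F (h + 1) e := rfl
/-- placed node sum after a merger [folklore] -/
@[simp] theorem nsumP_merge (W : ε → ℕ) (F : ℕ → ε → ℝ) (X Y : Gen ε) (e : ε) :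
    nsumP W F (Gen.merge X Y e) = nsumP W F X + nsumP W F Y + F (max (X.reach W) (Y.reach W)) e := rfl

/-- **NATURALITY OF THE NODE SUM** under relabelling by ANY map (no injectivity). [folklore] -/
theorem nsum_gmap (g : ε → ε') (f : ε' → ℝ) : ∀ G : Gen ε, nsum f (gmap g G) = nsum (f ∘ g) G
  | Gen.born _ _ => rfl
  | Gen.renew G e h => by simp [gmap, nsum_gmap g f G]
  | Gen.merge X Y e => by simp [gmap, nsum_gmap g f X, nsum_gmap g f Y]

/-- **NATURALITY OF THE PLACED NODE SUM** under relabelling by ANY map: the table and the letter pull back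
(`reach_gmap` for the merger placement). [folklore] -/
theorem nsumP_gmap (g : ε → ε') (W' : ε' → ℕ) (F : ℕ → ε' → ℝ) :
    ∀ G : Gen ε, nsumP W' F (gmap g G) = nsumP (W' ∘ g) (fun p e => F p (g e)) G
  | Gen.born _ _ => rfl
  | Gen.renew G e h => by simp [gmap, nsumP_gmap g W' F G]
  | Gen.merge X Y e => by simp [gmap, nsumP_gmap g W' F X, nsumP_gmap g W' F Y]

/-- node sums are additive in the letter [folklore] -/
theorem nsum_add (f f' : ε → ℝ) : ∀ G : Gen ε, nsum (fun e => f e + f' e) G = nsum f G + nsum f' G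
  | Gen.born _ _ => rfl
  | Gen.renew G e h => by simp [nsum_add f f' G]; ring
  | Gen.merge X Y e => by simp [nsum_add f f' X, nsum_add f f' Y]; ring

/-- node sums are monotone in the letter [folklore] -/
theorem nsum_le_nsum {f f' : ε → ℝ} (h : ∀ e, f e ≤ f' e) : ∀ G : Gen ε, nsum f G ≤ nsum f' G
  | Gen.born b _ => h b
  | Gen.renew G e _ => add_le_add (nsum_le_nsum h G) (h e)
  | Gen.merge X Y e => add_le_add (add_le_add (nsum_le_nsum h X) (nsum_le_nsum h Y)) (h e)

/-- node sums of a nonnegative letter are nonnegative [folklore] -/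
theorem nsum_nonneg {f : ε → ℝ} (h : ∀ e, 0 ≤ f e) : ∀ G : Gen ε, 0 ≤ nsum f G
  | Gen.born b _ => h b
  | Gen.renew G e _ => add_nonneg (nsum_nonneg h G) (h e)
  | Gen.merge X Y e => add_nonneg (add_nonneg (nsum_nonneg h X) (nsum_nonneg h Y)) (h e)

/-- placed node sums of a nonnegative letter are nonnegative [folklore] -/
theorem nsumP_nonneg {W : ε → ℕ} {F : ℕ → ε → ℝ} (h : ∀ p e, 0 ≤ F p e) : ∀ G : Gen ε, 0 ≤ nsumP W F G
  | Gen.born b j => h j b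
  | Gen.renew G e hh => add_nonneg (nsumP_nonneg h G) (h (hh + 1) e)
  | Gen.merge X Y e => add_nonneg (add_nonneg (nsumP_nonneg h X) (nsumP_nonneg h Y)) (h _ e)

end NodeSum

/-! ## §2 On well-formed genealogies the node sums ARE the event functionals -/

section WellFormed

variable {ε : Type*} [DecidableEq ε]

/-- **ON A WELL-FORMED GENEALOGY THE NODE SUM IS THE SUM OVER THE EVENT FINSET** (labels are distinct: `e ∉ events`,
`Disjoint` — `Gen.WF` for any table). [folklore] -/
theorem nsum_eq_sum_events {W : ε → ℕ} (f : ε → ℝ) : ∀ {G : Gen ε}, G.WF W → nsum f G = ∑ e ∈ G.events, f e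
  | Gen.born b _, _ => by simp
  | Gen.renew G e h, hG => by
      obtain ⟨hW, he, -, -⟩ := hG
      rw [nsum_renew, Gen.events_renew, sum_insert he, nsum_eq_sum_events f hW, add_comm]
  | Gen.merge X Y e, hG => by
      obtain ⟨hX, hY, heX, heY, hXY, -, -⟩ := hG
      have he : e ∉ X.events ∪ Y.events := by simp [heX, heY]
      rw [nsum_merge, Gen.events_merge, sum_insert he, sum_union hXY, nsum_eq_sum_events f hX,
        nsum_eq_sum_events f hY]
      ring

/-- **ON A WELL-FORMED GENEALOGY THE PLACED NODE SUM IS THE SUM OVER THE EVENT FINSET WITH `Gen.place`** (the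
positional placement IS the placement looked up by label when labels are distinct; well-formedness for ANY table `W′`,
placement against any table `W`). [folklore] -/
theorem nsumP_eq_sum_place {W' : ε → ℕ} (W : ε → ℕ) (F : ℕ → ε → ℝ) :
    ∀ {G : Gen ε}, G.WF W' → nsumP W F G = ∑ e ∈ G.events, F (G.place W e) e
  | Gen.born b j, _ => by simp
  | Gen.renew G e h, hG => by
      obtain ⟨hW, he, -, -⟩ := hG
      rw [nsumP_renew, Gen.events_renew, sum_insert he, Gen.place_renew_self, nsumP_eq_sum_place W F hW, add_comm]
      congr 1
      refine sum_congr rfl fun e' he' => ?_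
      have hne : e' ≠ e := fun h' => he (h' ▸ he')
      rw [Gen.place_renew, if_neg hne]
  | Gen.merge X Y e, hG => by
      obtain ⟨hX, hY, heX, heY, hXY, -, -⟩ := hG
      have he : e ∉ X.events ∪ Y.events := by simp [heX, heY]
      rw [nsumP_merge, Gen.events_merge, sum_insert he, Gen.place_merge_self, sum_union hXY,
        nsumP_eq_sum_place W F hX, nsumP_eq_sum_place W F hY]
      have hXs : ∑ e' ∈ X.events, F ((Gen.merge X Y e).place W e') e' = ∑ e' ∈ X.events, F (X.place W e') e' :=
        sum_congr rfl fun e' he' => by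
          have hne : e' ≠ e := fun h' => heX (h' ▸ he')
          rw [Gen.place_merge, if_neg hne, if_pos he']
      have hYs : ∑ e' ∈ Y.events, F ((Gen.merge X Y e).place W e') e' = ∑ e' ∈ Y.events, F (Y.place W e') e' :=
        sum_congr rfl fun e' he' => by
          have hne : e' ≠ e := fun h' => heY (h' ▸ he')
          have hnX : e' ∉ X.events := fun h' => disjoint_left.1 hXY h' he'
          rw [Gen.place_merge, if_neg hne, if_neg hnX]
      rw [hXs, hYs]
      ring

variable {W' : ε → ℕ}

/-- **`credits` IS A NODE SUM** on a well-formed genealogy. [folklore] -/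
theorem credits_eq_nsum (credit : ε → ℝ) {G : Gen ε} (hG : G.WF W') : credits credit G = nsum credit G :=
  (nsum_eq_sum_events credit hG).symm

/-- **`costT` IS A PLACED NODE SUM** on a well-formed genealogy (the booked per-step control cost at step `n`).
[folklore] -/
theorem costT_eq_nsumP (sh : ε → PEv) (C : T4PrintedShapeBanking.Consts) (K : ℕ) (R : ℕ → ℕ) {G : Gen ε}
    (hG : G.WF W') (n : ℕ) :
    costT sh C K R G n =
      nsumP (dictWT sh R C.n₁) (fun p e => wfloor C K R p (sh e) n + sz C K R (sh e) n) G := by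
  unfold costT
  exact (nsumP_eq_sum_place (dictWT sh R C.n₁) (fun p e => wfloor C K R p (sh e) n + sz C K R (sh e) n) hG).symm

/-- **`totalCostT` IS A PLACED NODE SUM** on a well-formed genealogy. [folklore] -/
theorem totalCostT_eq_nsumP (sh : ε → PEv) (C : T4PrintedShapeBanking.Consts) (K : ℕ) (R : ℕ → ℕ) {G : Gen ε}
    (hG : G.WF W') : totalCostT sh C K R G = nsumP (dictWT sh R C.n₁) (evCost sh C K R) G := by
  unfold totalCostT
  exact (nsumP_eq_sum_place _ _ hG).symm

/-- the birth-weight letter of an event: `u (step)·(fat + 1)` on births, `0` otherwise [folklore] -/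
def bwLetter (sh : ε → PEv) (u : ℕ → ℝ) (e : ε) : ℝ :=
  if (sh e).kind = 0 then u (sh e).step * (((sh e).fat : ℝ) + 1) else 0

omit [DecidableEq ε] in
/-- the birth-weight letter pulls back along the shape map [folklore] -/
theorem bwLetter_comp {ε' : Type*} (g : ε → ε') (sh' : ε' → PEv) (u : ℕ → ℝ) :
    bwLetter (sh' ∘ g) u = bwLetter sh' u ∘ g := rfl

/-- **`birthWT` IS A NODE SUM** on a well-formed genealogy. [folklore] -/
theorem birthWT_eq_nsum (sh : ε → PEv) (u : ℕ → ℝ) {G : Gen ε} (hG : G.WF W') :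
    birthWT sh u G = nsum (bwLetter sh u) G := by
  rw [nsum_eq_sum_events _ hG, birthWT, sum_filter]
  rfl

/-- **`lifeCost` OF `costT` IS A LIFE SUM OF PLACED NODE SUMS** on a well-formed genealogy. [folklore] -/
theorem lifeCost_costT_eq (sh : ε → PEv) (C : T4PrintedShapeBanking.Consts) (K : ℕ) (R : ℕ → ℕ) (Wl : ε → ℕ)
    {G : Gen ε} (hG : G.WF W') :
    lifeCost Wl (costT sh C K R) G =
      ∑ n ∈ life Wl G, nsumP (dictWT sh R C.n₁) (fun p e => wfloor C K R p (sh e) n + sz C K R (sh e) n) G := by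
  unfold lifeCost
  exact sum_congr rfl fun n _ => costT_eq_nsumP sh C K R hG n

end WellFormed

/-! ## §3 The flat letters and the flat price of a key; the tagged price factor is the flat price of the flattening -/

section Flat

/-- **FLAT CREDITS**: print's credits of a flat genealogy read NODE BY NODE. [folklore] -/
def creditsN (O : PrintedO1s) (C : T4PrintedShapeBanking.Consts) (g : ℕ → ℝ) (G : Gen PEv) : ℝ :=
  nsum (pcredit O C g) G

/-- **FLAT PER-STEP COST** at step `n`: the booked control cost read node by node with positional placement. [folklore] -/
def costN (C : T4PrintedShapeBanking.Consts) (K : ℕ) (R : ℕ → ℕ) (G : Gen PEv) (n : ℕ) : ℝ :=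
  nsumP (dictW R C.n₁) (fun p e => wfloor C K R p e n + sz C K R e n) G

/-- **FLAT LIFE COST** over the (padded) pending life. [folklore] -/
def lifeCostN (C : T4PrintedShapeBanking.Consts) (K : ℕ) (R : ℕ → ℕ) (D : ℕ) (G : Gen PEv) : ℝ :=
  ∑ n ∈ life (padW (dictW R C.n₁) D) G, costN C K R G n

/-- **FLAT TOTAL BOOKED COST**. [folklore] -/
def totalCostN (C : T4PrintedShapeBanking.Consts) (K : ℕ) (R : ℕ → ℕ) (G : Gen PEv) : ℝ :=
  nsumP (dictW R C.n₁) (evCost id C K R) G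

/-- **FLAT WEIGHTED BIRTH CONTENT**. [folklore] -/
def birthWN (u : ℕ → ℝ) (G : Gen PEv) : ℝ := nsum (bwLetter id u) G

/-- **THE FLAT PRICE OF A KEY LETTER** `G : Gen PEv`: the per-member factor of the VS-witness's `priceM` —
`pshapeTH … (costT …) · e^{birthWT u} · e^{−(8∕E₂·totalCostT + 4·partnerAges)}` — with every event functional replaced
by its node sum. [folklore] -/
def priceN (O : PrintedO1s) (C : T4PrintedShapeBanking.Consts) (K : ℕ) (Δ Λ' : ℝ) (R : ℕ → ℕ) (g : ℕ → ℝ) (D : ℕ)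
    (u : ℕ → ℝ) (G : Gen PEv) : ℝ :=
  Δ * (Λ' ^ partnerAges PEv.step G * (Real.exp (-creditsN O C g G) * Real.exp (lifeCostN C K R D G))) *
    Real.exp (birthWN u G) * Real.exp (-(8 / C.E₂ * totalCostN C K R G + 4 * (partnerAges PEv.step G : ℝ)))

/-- the flat price is nonnegative for `Δ, Λ′ ≥ 0` [folklore] -/
theorem priceN_nonneg {O : PrintedO1s} {C : T4PrintedShapeBanking.Consts} {K : ℕ} {Δ Λ' : ℝ} (hΔ : 0 ≤ Δ) (hΛ : 0 ≤ Λ')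
    (R : ℕ → ℕ) (g : ℕ → ℝ) (D : ℕ) (u : ℕ → ℝ) (G : Gen PEv) : 0 ≤ priceN O C K Δ Λ' R g D u G := by
  unfold priceN; positivity

variable {ε : Type*} [DecidableEq ε] (sh : ε → PEv) (O : PrintedO1s) (C : T4PrintedShapeBanking.Consts) (K : ℕ)
  (R : ℕ → ℕ) (g : ℕ → ℝ)

omit [DecidableEq ε] in
/-- an event's booked cost is its shape's booked cost [folklore] -/
theorem evCost_eq_evCost_sh (p : ℕ) (e : ε) : evCost sh C K R p e = evCost id C K R p (sh e) := rfl

omit [DecidableEq ε] in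
/-- flat credits pull back: `creditsN (gmap sh G) = nsum (pcredit ∘ sh) G` [folklore] -/
theorem creditsN_gmap (G : Gen ε) : creditsN O C g (gmap sh G) = nsum (pcredit O C g ∘ sh) G := nsum_gmap _ _ G

omit [DecidableEq ε] in
/-- flat per-step cost pulls back [folklore] -/
theorem costN_gmap (G : Gen ε) (n : ℕ) :
    costN C K R (gmap sh G) n = nsumP (dictWT sh R C.n₁) (fun p e => wfloor C K R p (sh e) n + sz C K R (sh e) n) G :=
  nsumP_gmap _ _ _ G

omit [DecidableEq ε] in
/-- flat total cost pulls back [folklore] -/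
theorem totalCostN_gmap (G : Gen ε) : totalCostN C K R (gmap sh G) = nsumP (dictWT sh R C.n₁) (evCost sh C K R) G :=
  nsumP_gmap _ _ _ G

omit [DecidableEq ε] in
/-- flat birth content pulls back [folklore] -/
theorem birthWN_gmap (u : ℕ → ℝ) (G : Gen ε) : birthWN u (gmap sh G) = nsum (bwLetter sh u) G := nsum_gmap _ _ G

omit [DecidableEq ε] in
/-- the (padded) life pulls back: root step and reach are structural [folklore] -/
theorem life_padW_gmap (D : ℕ) (G : Gen ε) :
    life (padW (dictW R C.n₁) D) (gmap sh G) = life (padW (dictWT sh R C.n₁) D) G := by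
  unfold life
  rw [rootStep_gmap, reach_gmap]
  rfl

omit [DecidableEq ε] in
/-- flat life cost pulls back [folklore] -/
theorem lifeCostN_gmap (D : ℕ) (G : Gen ε) :
    lifeCostN C K R D (gmap sh G) =
      ∑ n ∈ life (padW (dictWT sh R C.n₁) D) G,
        nsumP (dictWT sh R C.n₁) (fun p e => wfloor C K R p (sh e) n + sz C K R (sh e) n) G := by
  unfold lifeCostN
  rw [life_padW_gmap]
  exact sum_congr rfl fun n _ => costN_gmap sh C K R G n

variable {sh O C K R g} {W' : ε → ℕ}

/-- **ON A WELL-FORMED TAGGED GENEALOGY, PRINT's CREDITS ARE THE FLAT CREDITS OF ITS FLATTENING.** [folklore] -/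
theorem credits_eq_creditsN_gmap {G : Gen ε} (hG : G.WF W') :
    credits (pcredit O C g ∘ sh) G = creditsN O C g (gmap sh G) := by
  rw [creditsN_gmap, credits_eq_nsum _ hG]

/-- **… THE LIFE COST OF `costT` IS THE FLAT LIFE COST OF THE FLATTENING.** [folklore] -/
theorem lifeCost_eq_lifeCostN_gmap (D : ℕ) {G : Gen ε} (hG : G.WF W') :
    lifeCost (padW (dictWT sh R C.n₁) D) (costT sh C K R) G = lifeCostN C K R D (gmap sh G) := by
  rw [lifeCostN_gmap, lifeCost_costT_eq sh C K R _ hG]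

/-- **… THE TOTAL BOOKED COST IS THE FLAT TOTAL COST OF THE FLATTENING.** [folklore] -/
theorem totalCostT_eq_totalCostN_gmap {G : Gen ε} (hG : G.WF W') :
    totalCostT sh C K R G = totalCostN C K R (gmap sh G) := by
  rw [totalCostN_gmap, totalCostT_eq_nsumP sh C K R hG]

/-- **… THE WEIGHTED BIRTH CONTENT IS THE FLAT ONE OF THE FLATTENING.** [folklore] -/
theorem birthWT_eq_birthWN_gmap (u : ℕ → ℝ) {G : Gen ε} (hG : G.WF W') :
    birthWT sh u G = birthWN u (gmap sh G) := by
  rw [birthWN_gmap, birthWT_eq_nsum sh u hG]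

/-- **… AND THE PRINT-PRICED SHAPE IS THE FLAT ONE OF THE FLATTENING** (`pshapeTH` through `sh` with `κ := costT sh`).
[folklore] -/
theorem pshapeTH_costT_eq_gmap (Δ Λ' : ℝ) (D : ℕ) {G : Gen ε} (hG : G.WF W') :
    pshapeTH sh O C Δ Λ' R g D (costT sh C K R) G =
      Δ * (Λ' ^ partnerAges PEv.step (gmap sh G) *
        (Real.exp (-creditsN O C g (gmap sh G)) * Real.exp (lifeCostN C K R D (gmap sh G)))) := by
  rw [pshapeTH, partnerAges_gmap, credits_eq_creditsN_gmap hG, lifeCost_eq_lifeCostN_gmap D hG]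

/-- **THE PER-MEMBER PRICE FACTOR OF `priceM` AT A WELL-FORMED TAGGED GENEALOGY IS THE FLAT PRICE OF ITS KEY LETTER**
(IR-45-1, E-side, module A's headline): the tagged reading through `sh` and the node-sum reading of `gmap sh G` agree —
structural letters by `partnerAges_gmap`, event functionals by §2 — for EVERY shape map `sh`, injective or not.
[folklore] -/
theorem priceFactor_eq_priceN_gmap (Δ Λ' : ℝ) (D : ℕ) (u : ℕ → ℝ) {G : Gen ε} (hG : G.WF W') :
    pshapeTH sh O C Δ Λ' R g D (costT sh C K R) G * Real.exp (birthWT sh u G) *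
        Real.exp (-(8 / C.E₂ * totalCostT sh C K R G + 4 * (partnerAges (PEv.step ∘ sh) G : ℝ))) =
      priceN O C K Δ Λ' R g D u (gmap sh G) := by
  rw [priceN, pshapeTH_costT_eq_gmap Δ Λ' D hG, birthWT_eq_birthWN_gmap u hG, totalCostT_eq_totalCostN_gmap hG,
    partnerAges_gmap]

/-- **IN PARTICULAR FOR A PEDIGREE's TAGGED GENEALOGY** (`sh := Prod.fst`, `Pedigree.gen c = gmap Prod.fst (genT c)` by
definition): the `priceM` factor of the member `genT c` is the flat price of the key letter `gen c`. [folklore] -/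
theorem priceFactor_genT_eq_priceN_gen {α π : Type*} [DecidableEq α] [DecidableEq π] (P : HistoryGen.Pedigree α π)
    (c : α) {W' : HistoryGen.Lab α π → ℕ} (hW : (P.genT c).WF W') (O : PrintedO1s) (C : T4PrintedShapeBanking.Consts)
    (K : ℕ) (Δ Λ' : ℝ) (R : ℕ → ℕ) (g : ℕ → ℝ) (D : ℕ) (u : ℕ → ℝ) :
    pshapeTH Prod.fst O C Δ Λ' R g D (costT Prod.fst C K R) (P.genT c) * Real.exp (birthWT Prod.fst u (P.genT c)) *
        Real.exp (-(8 / C.E₂ * totalCostT Prod.fst C K R (P.genT c) +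
          4 * (partnerAges (PEv.step ∘ Prod.fst) (P.genT c) : ℝ))) =
      priceN O C K Δ Λ' R g D u (P.gen c) :=
  priceFactor_eq_priceN_gmap Δ Λ' D u hW

end Flat

end

end Summit.QuantumFields.BalabanUV.T4Continuum.HistoryPriceNodeSum
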